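import Summits.QuantumFields.YangMills.Theorems.FluctuationComparisonRegPrIntLOrganTangentJTSqOfHdispCrude
import Summits.QuantumFields.YangMills.Theorems.FluctuationComparisonRegPrIntLOrganTangentGoodSetTailVariance
import HarnessLib

/-!
# Crux `FluctuationComparisonRegPrIntL` (stmt-QuantumFields-20520, rung R3), PATH-B organ — «A5 AT ENDPOINT TAILS»: the (JT-h)sq door with a crude good-set letter
# (✓`…OrganTangentJTSqOfHdispCrude`, amendment A5) whose per-`t` tail pair `(hES, htail)` is REPLACED by the three (xv-b) letters of LEAD №68's bridge
# (✓`…OrganTangentGoodSetTailVariance`): two ENDPOINT tails of `Goodᶜ` and ONE path-variance letter; DEFINITION-FREE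

Cell `ym3-torus` (YM ladder rung R3 = continuum `SU(2)` Yang–Mills on the three-torus — a RUNG: NOT d = 4, NOT infinite volume, NOT a mass gap, NOT Clay).
Width seat `ym3-torus-px19` (gen 24; the A5-door lineage ✓p823618 = px19 g22); `--kind proof --supports stmt-QuantumFields-20520 --as helper`, count-neutral, no registry ∕
binder ∕ `Lines/` edit, default heartbeats, `autoImplicit false`.  NO ROW EDITION is made or implied (ROW-sq v0.4ᴱ of record untouched; RULING №59's trigger discipline):
this is the door an «endpoint tails» edition of the (I-curv) row's Good-set clause WOULD call in place of ✓p823618 — typed now as a no-regret artefact (SPEC v1.11 §11 (xv-b);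
LEAD `ym-ust-20520-w3` g28 №60∕№63∕№64∕№68∕№73).

WHAT.  Two theorems, each = the corresponding theorem of ✓`…OrganTangentJTSqOfHdispCrude` with EXACTLY two binder changes and every other binder VERBATIM:
(i) `(t : ℝ)` ↦ `(t : ℝ) (ht0 : 0 ≤ t) (ht1 : t ≤ 1)`; (ii) the per-`t` tail pair `{kB ES : ℝ} (hkB) (hES : 0 ≤ ES) (hcrude) (htail : ∫ z in Goodᶜ, ŵ_t(Xw,z) dτ ≤ ES)` ↦
`{kB ES₀ ES₁ σ2 : ℝ} (hkB) (hES₀ : 0 ≤ ES₀) (hcrude) (htail₀ : ∫ z in Goodᶜ, ŵ₀(Xw,z) dτ ≤ ES₀) (htail₁ : ∫ z in Goodᶜ, ŵ₁(Xw,z) dτ ≤ ES₁)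
 (hvar : ∀ u ∈ [0,1], ∫ ŵ_u(Xw,·)·(h_Ts∘Φ(Xw,·) − ∫ ŵ_u(Xw,·)·h_Ts∘Φ(Xw,·) dτ)² dτ ≤ σ2)` (✓`…GoodSetTailVariance`'s `hvar` text at `V := Xw`); the conclusion is the door's
with the letter `ES` replaced by `max ES₀ ES₁ · exp(σ2∕4)`:

* ★★`jtBracket_of_cornerStability_crude_endpointTails` — the corner-stability door ✓`jtBracket_of_cornerStability_crude`, endpoint-tails edition;
* ★★★`jtBracket_sq_of_hdisp_crude_endpointTails` — the knit line ✓`jtBracket_sq_of_hdisp_crude` (from the row's `hdisp` + cap + near room + corner disjunction),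
  endpoint-tails edition.

Proof (both): ✓`…GoodSetTailVariance.setIntegral_wgt_le_of_endpointTails_pathVariance` at the law point `V := Xw` (a `θ_j∕4`-small point is `θ_j`-small) and
`A := Goodᶜ` yields the pair `0 ≤ max ES₀ ES₁·e^{σ2∕4} ∧ ∫_{Goodᶜ} ŵ_t(Xw,·) ≤ max ES₀ ES₁·e^{σ2∕4}`, which is fed to the original door as `(hES, htail)`.

WHY.  With ✓p832486 (tilted-path event bound) → ✓p832596 (fibre corollary) → ✓p832714 (mean-shift edition) → ✓`JensenGapVariance` → ✓`…GoodSetTailVariance` the (xv-b) item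
«A5 TAIL THRESHOLD» reads, BY NAME at the A5 door: {`ES₀`, `ES₁` = the two ENDPOINT conditional-fibre-law tails of the annulus `(θ_Ts∕4 − 3·Db·rc, 24∕25·θ_Ts)` (print's
[Balaban1985UV3] (71)-type, OPEN), `σ2` = an absolute path variance of `h_Ts∘Φ(Xw,·)` along the interpolated fibre laws (D4-type, OPEN)} — no per-`t` law estimate, no
sup-norm of `h`.

HONEST FRAMING: composition of landed doors over HYPOTHESIS letters; nothing of Bałaban's analysis ((71) included) is asserted or proved; (xv-b) is NOT discharged; the
(I-curv) row (every edition), `SpreadFibreLawHJ(sq)`(ᴱ), `OrganDischargeInputsHJ(sq)` v0.1–v0.4ᴱ UNDISCHARGED; the five registered stubs of `Lines/runpair_organ.lean`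
(registry 3732b7df, untouched), crux 20520 `FluctuationComparisonRegPrIntL` and `YM3TorusSU2` are NOT proved; rung R3 = SU(2) YM₃ on T³ at fixed lattice data — NOT
d = 4, NOT infinite volume, NOT a mass gap, NOT Clay; the Yang–Mills mass gap is NOT proved.  [folklore]
-/

set_option autoImplicit false

noncomputable section

namespace Summit.QuantumFields.YangMills.Theorems.OrganTangentJTSqOfEndpointTails

open MeasureTheory Filter Topology Function Set
open scoped ENNReal NNReal BigOperators
open Literature.MathematicalPhysics.QuantumFieldTheory.Balaban1983to89 T3ContinuumYM3Torus T3NestedUnitLaws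
  T3UnitLawDensityEML T4Continuum BalabanUVClass T3UnitScaleTilt T3LevelShift T3TiltDescent
open T4CubeChartExp (expPt)
open Summit.QuantumFields.YangMills.Theorems.FluctuationComparisonRegPrIntLRunpairOrganFibreLaw (mwCut wNum wgt)
open Summit.QuantumFields.YangMills.Theorems.OrganTangentJTSqOfHdispCrude (jtBracket_of_cornerStability_crude jtBracket_sq_of_hdisp_crude)
open Summit.QuantumFields.YangMills.Theorems.OrganTangentGoodSetTailVariance (setIntegral_wgt_le_of_endpointTails_pathVariance)

/-- ★★ **JT-E2E FROM CORNER STABILITY WITH A CRUDE GOOD-SET LETTER — ENDPOINT-TAILS EDITION.**  The A5 door ✓`…OrganTangentJTSqOfHdispCrude.jtBracket_of_cornerStability_crude`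
with its per-`t` tail pair `(hES : 0 ≤ ES) (htail : ∫_{Goodᶜ} ŵ_t(Xw,·) dτ ≤ ES)` REPLACED by the three (xv-b) letters of LEAD №68's bridge
✓`…OrganTangentGoodSetTailVariance.setIntegral_wgt_le_of_endpointTails_pathVariance`: the two ENDPOINT tails `htail₀ : ∫_{Goodᶜ} ŵ₀(Xw,·) ≤ ES₀`, `htail₁ : ∫_{Goodᶜ} ŵ₁(Xw,·) ≤ ES₁`
(`hES₀ : 0 ≤ ES₀`) and the PATH-VARIANCE letter `hvar : ∀ u ∈ [0,1], Var_{ŵ_u(Xw,·)}(h_Ts∘Φ(Xw,·)) ≤ σ2` (displayed as an integral); `t` is restricted to `[0,1]`.  Every other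
binder is the door's VERBATIM; the conclusion is the door's with `ES := max ES₀ ES₁ · exp(σ2∕4)`.  Proof: the bridge at `V := Xw` (a `θ_j∕4`-small point is `θ_j`-small), then
the door. [folklore] -/
theorem jtBracket_of_cornerStability_crude_endpointTails (F : T3Family) (γ b₀ p₀ : ℝ) (j Ts : ℕ) (hjTs : j + 1 ≤ Ts)
    (ρ ρ' : (i : ℕ) → GaugeField (F.P i) 0 ↥(Matrix.specialUnitaryGroup (Fin 2) ℂ) → ℝ)
    (hρm : Measurable (ρ Ts)) (hρ'm : Measurable (ρ' Ts))
    (hρc : ContinuousOn (ρ Ts) {U | PlaqSmall (θBal F.L γ b₀ p₀ Ts) U}) (hρ'c : ContinuousOn (ρ' Ts) {U | PlaqSmall (θBal F.L γ b₀ p₀ Ts) U})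
    (hρpos : ∀ U, PlaqSmall (θBal F.L γ b₀ p₀ Ts) U → 0 < ρ Ts U ∧ 0 < ρ' Ts U)
    (hθ : 0 < θBal F.L γ b₀ p₀ Ts) (hθj : 0 < θBal F.L γ b₀ p₀ j)
    (hχc : Continuous (mwCut F γ b₀ p₀ j Ts)) (hχ0 : ∀ U, 0 ≤ mwCut F γ b₀ p₀ j Ts U)
    (hχsupp : ∀ U, mwCut F γ b₀ p₀ j Ts U ≠ 0 → ∀ (n : ℕ) (hjn : j + 1 ≤ n) (hnK : n ≤ Ts), PlaqSmall (24 / 25 * θBal F.L γ b₀ p₀ n) (descendTo F ℰp n Ts hnK U))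
    (hχpos : ∀ U, (∀ (n : ℕ) (hjn : j + 1 ≤ n) (hnK : n ≤ Ts), PlaqSmall (24 / 25 * θBal F.L γ b₀ p₀ n) (descendTo F ℰp n Ts hnK U)) → 0 < mwCut F γ b₀ p₀ j Ts U)
    {Z : Type} [MeasurableSpace Z] (τ : Measure Z) [IsProbabilityMeasure τ]
    (Φ : GaugeField (F.P j) 0 ↥(Matrix.specialUnitaryGroup (Fin 2) ℂ) × Z → GaugeField (F.P Ts) 0 ↥(Matrix.specialUnitaryGroup (Fin 2) ℂ))
    (J : GaugeField (F.P j) 0 ↥(Matrix.specialUnitaryGroup (Fin 2) ℂ) × Z → ℝ≥0)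
    (hΦm : Measurable Φ) (hJm : Measurable J) (CJ : ℝ) (hJle : ∀ V z, (J (V, z) : ℝ) ≤ CJ)
    (hpos : ∀ V, PlaqSmall (θBal F.L γ b₀ p₀ j) V →
      0 < ∫⁻ z in {z | (∀ (n : ℕ) (hjn : j + 1 ≤ n) (hnK : n ≤ Ts), PlaqSmall (24 / 25 * θBal F.L γ b₀ p₀ n) (descendTo F ℰp n Ts hnK (Φ (V, z))))},
        (J (V, z) : ℝ≥0∞) ∂τ)
    (t : ℝ) (ht0 : 0 ≤ t) (ht1 : t ≤ 1)
    -- (β′) CORNER STABILITY: the four PAIR-LOCAL square-stability texts at the corners w.r.t. the law point `Xw` — HYPOTHESES here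
    {c : ℝ} (hc : c < 1)
    (m m' : Fin 3 → ℝ) (U V W Y Xw : GaugeField (F.P j) 0 ↥(Matrix.specialUnitaryGroup (Fin 2) ℂ))
    (hXw : PlaqSmall (θBal F.L γ b₀ p₀ j / 4) Xw)
    (hstabU : ∀ z, mwCut F γ b₀ p₀ j Ts (Φ (Xw, z)) ≠ 0 → ∀ p, dist1 (GaugeField.plaqHol (Φ (U, z)) p) ≤ c * θBal F.L γ b₀ p₀ Ts)
    (hstabV : ∀ z, mwCut F γ b₀ p₀ j Ts (Φ (Xw, z)) ≠ 0 → ∀ p, dist1 (GaugeField.plaqHol (Φ (V, z)) p) ≤ c * θBal F.L γ b₀ p₀ Ts)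
    (hstabW : ∀ z, mwCut F γ b₀ p₀ j Ts (Φ (Xw, z)) ≠ 0 → ∀ p, dist1 (GaugeField.plaqHol (Φ (W, z)) p) ≤ c * θBal F.L γ b₀ p₀ Ts)
    (hstabY : ∀ z, mwCut F γ b₀ p₀ j Ts (Φ (Xw, z)) ≠ 0 → ∀ p, dist1 (GaugeField.plaqHol (Φ (Y, z)) p) ≤ c * θBal F.L γ b₀ p₀ Ts)
    -- (γ-crude) the CRUDE good-set pair letter `kG` — a HYPOTHESIS
    (Good : Set Z) (hGood : MeasurableSet Good)
    {kG : ℝ} (hkG : 0 ≤ kG)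
    (hG : ∀ z ∈ Good, wgt F γ b₀ p₀ j Ts ρ ρ' τ Φ J t Xw z ≠ 0 →
      |(Real.log (ρ Ts (Φ (Y, z))) - Real.log (ρ' Ts (Φ (Y, z)))) - (Real.log (ρ Ts (Φ (V, z))) - Real.log (ρ' Ts (Φ (V, z))))
        - (Real.log (ρ Ts (Φ (W, z))) - Real.log (ρ' Ts (Φ (W, z)))) + (Real.log (ρ Ts (Φ (U, z))) - Real.log (ρ' Ts (Φ (U, z))))|
        ≤ kG * (‖m‖ / (θBal F.L γ b₀ p₀ j / 4)) * (‖m'‖ / (θBal F.L γ b₀ p₀ j / 4)))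
    -- (δ) crude letter on the law's support; (xv-b) ENDPOINT tails of the good set + PATH VARIANCE (in place of the per-`t` tail)
    {kB ES₀ ES₁ σ2 : ℝ} (hkB : 0 ≤ kB) (hES₀ : 0 ≤ ES₀)
    (hcrude : ∀ z, wgt F γ b₀ p₀ j Ts ρ ρ' τ Φ J t Xw z ≠ 0 →
      |(Real.log (ρ Ts (Φ (Y, z))) - Real.log (ρ' Ts (Φ (Y, z)))) - (Real.log (ρ Ts (Φ (V, z))) - Real.log (ρ' Ts (Φ (V, z))))
        - (Real.log (ρ Ts (Φ (W, z))) - Real.log (ρ' Ts (Φ (W, z)))) + (Real.log (ρ Ts (Φ (U, z))) - Real.log (ρ' Ts (Φ (U, z))))|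
        ≤ kB * (‖m‖ / (θBal F.L γ b₀ p₀ j / 4)) * (‖m'‖ / (θBal F.L γ b₀ p₀ j / 4)))
    (htail₀ : ∫ z in Goodᶜ, wgt F γ b₀ p₀ j Ts ρ ρ' τ Φ J 0 Xw z ∂τ ≤ ES₀)
    (htail₁ : ∫ z in Goodᶜ, wgt F γ b₀ p₀ j Ts ρ ρ' τ Φ J 1 Xw z ∂τ ≤ ES₁)
    (hvar : ∀ u ∈ Set.Icc (0 : ℝ) 1,
      ∫ z, wgt F γ b₀ p₀ j Ts ρ ρ' τ Φ J u Xw z *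
          (Real.log (ρ Ts (Φ (Xw, z))) - Real.log (ρ' Ts (Φ (Xw, z)))
            - ∫ x, wgt F γ b₀ p₀ j Ts ρ ρ' τ Φ J u Xw x * (Real.log (ρ Ts (Φ (Xw, x))) - Real.log (ρ' Ts (Φ (Xw, x)))) ∂τ) ^ 2 ∂τ ≤ σ2) :
    Integrable (fun z => (Real.log (ρ Ts (Φ (U, z))) - Real.log (ρ' Ts (Φ (U, z)))) * (wgt F γ b₀ p₀ j Ts ρ ρ' τ Φ J t) Xw z) τ ∧
    Integrable (fun z => (Real.log (ρ Ts (Φ (V, z))) - Real.log (ρ' Ts (Φ (V, z)))) * (wgt F γ b₀ p₀ j Ts ρ ρ' τ Φ J t) Xw z) τ ∧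
    Integrable (fun z => (Real.log (ρ Ts (Φ (W, z))) - Real.log (ρ' Ts (Φ (W, z)))) * (wgt F γ b₀ p₀ j Ts ρ ρ' τ Φ J t) Xw z) τ ∧
    Integrable (fun z => (Real.log (ρ Ts (Φ (Y, z))) - Real.log (ρ' Ts (Φ (Y, z)))) * (wgt F γ b₀ p₀ j Ts ρ ρ' τ Φ J t) Xw z) τ ∧
    |∫ z, ((Real.log (ρ Ts (Φ (Y, z))) - Real.log (ρ' Ts (Φ (Y, z)))) - (Real.log (ρ Ts (Φ (V, z))) - Real.log (ρ' Ts (Φ (V, z))))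
      - (Real.log (ρ Ts (Φ (W, z))) - Real.log (ρ' Ts (Φ (W, z)))) + (Real.log (ρ Ts (Φ (U, z))) - Real.log (ρ' Ts (Φ (U, z)))))
        * (wgt F γ b₀ p₀ j Ts ρ ρ' τ Φ J t) Xw z ∂τ|
      ≤ (kG + (max ES₀ ES₁ * Real.exp (σ2 / 4)) * kB)
        * (‖m‖ / (θBal F.L γ b₀ p₀ j / 4)) * (‖m'‖ / (θBal F.L γ b₀ p₀ j / 4)) := by
  have hXw' : PlaqSmall (θBal F.L γ b₀ p₀ j) Xw := fun p => (hXw p).trans_le (div_le_self hθj.le (by norm_num))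
  obtain ⟨hES, htail⟩ := setIntegral_wgt_le_of_endpointTails_pathVariance F γ b₀ p₀ j Ts hjTs ρ ρ' hρm hρ'm hρc hρ'c hρpos hθ hχc hχ0 hχsupp hχpos
    τ Φ J hΦm hJm CJ hJle hpos t ht0 ht1 Xw hXw' hGood.compl hES₀ htail₀ htail₁ hvar
  exact jtBracket_of_cornerStability_crude F γ b₀ p₀ j Ts hjTs ρ ρ' hρm hρ'm hρc hρ'c hρpos hθ hθj hχc hχ0 hχsupp hχpos τ Φ J hΦm hJm CJ hJle hpos t hc
    m m' U V W Y Xw hXw hstabU hstabV hstabW hstabY Good hGood hkG hG hkB hES hcrude htail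

/-- ★★★ **(JT-h)sq FROM THE ROW's ONE-BOND LETTER WITH A CRUDE GOOD-SET LETTER — ENDPOINT-TAILS EDITION.**  ✓`…OrganTangentJTSqOfHdispCrude.jtBracket_sq_of_hdisp_crude` (the A5
knit line) with `(t : ℝ)` ↦ `(t : ℝ) (ht0 : 0 ≤ t) (ht1 : t ≤ 1)` and the per-`t` tail pair `(hES) … (htail)` ↦ `(hES₀) … (htail₀) (htail₁) (hvar)` (endpoint tails of `Goodᶜ`
under `ŵ₀(Xw,·)`, `ŵ₁(Xw,·)` + the path variance of `h_Ts∘Φ(Xw,·)`); every other binder VERBATIM; conclusion the door's with `ES := max ES₀ ES₁ · exp(σ2∕4)`.  This is the door an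
«endpoint tails» edition of the (I-curv) row's Good-set clause would call in place of ✓p823618 (SPEC v1.11 (xv-b); LEAD №60∕№68; RULING №59's trigger discipline: NO row
edition is made here). [folklore] -/
theorem jtBracket_sq_of_hdisp_crude_endpointTails (F : T3Family) (γ b₀ p₀ : ℝ) (j Ts : ℕ) (hjTs : j + 1 ≤ Ts)
    (ρ ρ' : (i : ℕ) → GaugeField (F.P i) 0 ↥(Matrix.specialUnitaryGroup (Fin 2) ℂ) → ℝ)
    (hρm : Measurable (ρ Ts)) (hρ'm : Measurable (ρ' Ts))
    (hρc : ContinuousOn (ρ Ts) {U | PlaqSmall (θBal F.L γ b₀ p₀ Ts) U}) (hρ'c : ContinuousOn (ρ' Ts) {U | PlaqSmall (θBal F.L γ b₀ p₀ Ts) U})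
    (hρpos : ∀ U, PlaqSmall (θBal F.L γ b₀ p₀ Ts) U → 0 < ρ Ts U ∧ 0 < ρ' Ts U)
    (hθ : 0 < θBal F.L γ b₀ p₀ Ts) (hθj : 0 < θBal F.L γ b₀ p₀ j)
    (hχc : Continuous (mwCut F γ b₀ p₀ j Ts)) (hχ0 : ∀ U, 0 ≤ mwCut F γ b₀ p₀ j Ts U)
    (hχsupp : ∀ U, mwCut F γ b₀ p₀ j Ts U ≠ 0 → ∀ (n : ℕ) (hjn : j + 1 ≤ n) (hnK : n ≤ Ts), PlaqSmall (24 / 25 * θBal F.L γ b₀ p₀ n) (descendTo F ℰp n Ts hnK U))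
    (hχpos : ∀ U, (∀ (n : ℕ) (hjn : j + 1 ≤ n) (hnK : n ≤ Ts), PlaqSmall (24 / 25 * θBal F.L γ b₀ p₀ n) (descendTo F ℰp n Ts hnK U)) → 0 < mwCut F γ b₀ p₀ j Ts U)
    {Z : Type} [MeasurableSpace Z] (τ : Measure Z) [IsProbabilityMeasure τ]
    (Φ : GaugeField (F.P j) 0 ↥(Matrix.specialUnitaryGroup (Fin 2) ℂ) × Z → GaugeField (F.P Ts) 0 ↥(Matrix.specialUnitaryGroup (Fin 2) ℂ))
    (J : GaugeField (F.P j) 0 ↥(Matrix.specialUnitaryGroup (Fin 2) ℂ) × Z → ℝ≥0)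
    (hΦm : Measurable Φ) (hJm : Measurable J) (CJ : ℝ) (hJle : ∀ V z, (J (V, z) : ℝ) ≤ CJ)
    (hpos : ∀ V, PlaqSmall (θBal F.L γ b₀ p₀ j) V →
      0 < ∫⁻ z in {z | (∀ (n : ℕ) (hjn : j + 1 ≤ n) (hnK : n ≤ Ts), PlaqSmall (24 / 25 * θBal F.L γ b₀ p₀ n) (descendTo F ℰp n Ts hnK (Φ (V, z))))},
        (J (V, z) : ℝ≥0∞) ∂τ)
    (t : ℝ) (ht0 : 0 ≤ t) (ht1 : t ≤ 1)
    {rc c : ℝ} (hc : c < 1)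
    -- the square and the law point
    (B B' : PBond (F.P j) 0) (m m' : Fin 3 → ℝ) (U V W Y Xw : GaugeField (F.P j) 0 ↥(Matrix.specialUnitaryGroup (Fin 2) ℂ))
    (hm : ‖m‖ ≤ rc * (θBal F.L γ b₀ p₀ j / 4)) (hm' : ‖m'‖ ≤ rc * (θBal F.L γ b₀ p₀ j / 4))
    (hU : PlaqSmall (θBal F.L γ b₀ p₀ j / 4) U) (hV : PlaqSmall (θBal F.L γ b₀ p₀ j / 4) V) (hW : PlaqSmall (θBal F.L γ b₀ p₀ j / 4) W)
    (hY : PlaqSmall (θBal F.L γ b₀ p₀ j / 4) Y) (hXw : PlaqSmall (θBal F.L γ b₀ p₀ j / 4) Xw)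
    (hVU : ∀ e, e ≠ B → V e = U e) (hVb : V B = U B * expPt m) (hWU : ∀ e, e ≠ B' → W e = U e) (hWb : W B' = U B' * expPt m')
    (hYV : ∀ e, e ≠ B' → Y e = V e) (hYb : Y B' = V B' * expPt m')
    -- (β-sq) the ROW's one-bond displacement text `hdisp`, uniform cap, NEAR room `3·Db·rc`, law point a CORNER
    (Db : ℝ) (hrc0 : 0 ≤ rc) (hDb0 : 0 ≤ Db) (DP : Plaq (F.P Ts) 0 → PBond (F.P j) 0 → ℝ) (hDb : ∀ p b, DP p b ≤ Db)
    (hdisp : ∀ (z : Z) (X : GaugeField (F.P j) 0 ↥(Matrix.specialUnitaryGroup (Fin 2) ℂ)), PlaqSmall (θBal F.L γ b₀ p₀ j) X →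
      ∀ (b : PBond (F.P j) 0) (v : Fin 3 → ℝ), ‖v‖ ≤ rc * (θBal F.L γ b₀ p₀ j / 4) → ∀ s ∈ Icc (0 : ℝ) 1, ∀ p : Plaq (F.P Ts) 0,
        dist1 (GaugeField.plaqHol (Φ (update X b (X b * expPt (s • v)), z)) p)
          ≤ dist1 (GaugeField.plaqHol (Φ (X, z)) p) + DP p b * (‖v‖ / (θBal F.L γ b₀ p₀ j / 4)))
    (hroom : 24 / 25 * θBal F.L γ b₀ p₀ Ts + 3 * (Db * rc) ≤ c * θBal F.L γ b₀ p₀ Ts)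
    (hXwc : Xw = U ∨ Xw = V ∨ Xw = W ∨ Xw = Y)
    -- (γ-crude) the CRUDE good-set pair letter `kG` — a HYPOTHESIS
    (Good : Set Z) (hGood : MeasurableSet Good)
    {kG : ℝ} (hkG : 0 ≤ kG)
    (hG : ∀ z ∈ Good, wgt F γ b₀ p₀ j Ts ρ ρ' τ Φ J t Xw z ≠ 0 →
      |(Real.log (ρ Ts (Φ (Y, z))) - Real.log (ρ' Ts (Φ (Y, z)))) - (Real.log (ρ Ts (Φ (V, z))) - Real.log (ρ' Ts (Φ (V, z))))
        - (Real.log (ρ Ts (Φ (W, z))) - Real.log (ρ' Ts (Φ (W, z)))) + (Real.log (ρ Ts (Φ (U, z))) - Real.log (ρ' Ts (Φ (U, z))))|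
        ≤ kG * (‖m‖ / (θBal F.L γ b₀ p₀ j / 4)) * (‖m'‖ / (θBal F.L γ b₀ p₀ j / 4)))
    -- (δ) crude letter on the law's support; (xv-b) ENDPOINT tails of the good set + PATH VARIANCE (in place of the per-`t` tail)
    {kB ES₀ ES₁ σ2 : ℝ} (hkB : 0 ≤ kB) (hES₀ : 0 ≤ ES₀)
    (hcrude : ∀ z, wgt F γ b₀ p₀ j Ts ρ ρ' τ Φ J t Xw z ≠ 0 →
      |(Real.log (ρ Ts (Φ (Y, z))) - Real.log (ρ' Ts (Φ (Y, z)))) - (Real.log (ρ Ts (Φ (V, z))) - Real.log (ρ' Ts (Φ (V, z))))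
        - (Real.log (ρ Ts (Φ (W, z))) - Real.log (ρ' Ts (Φ (W, z)))) + (Real.log (ρ Ts (Φ (U, z))) - Real.log (ρ' Ts (Φ (U, z))))|
        ≤ kB * (‖m‖ / (θBal F.L γ b₀ p₀ j / 4)) * (‖m'‖ / (θBal F.L γ b₀ p₀ j / 4)))
    (htail₀ : ∫ z in Goodᶜ, wgt F γ b₀ p₀ j Ts ρ ρ' τ Φ J 0 Xw z ∂τ ≤ ES₀)
    (htail₁ : ∫ z in Goodᶜ, wgt F γ b₀ p₀ j Ts ρ ρ' τ Φ J 1 Xw z ∂τ ≤ ES₁)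
    (hvar : ∀ u ∈ Set.Icc (0 : ℝ) 1,
      ∫ z, wgt F γ b₀ p₀ j Ts ρ ρ' τ Φ J u Xw z *
          (Real.log (ρ Ts (Φ (Xw, z))) - Real.log (ρ' Ts (Φ (Xw, z)))
            - ∫ x, wgt F γ b₀ p₀ j Ts ρ ρ' τ Φ J u Xw x * (Real.log (ρ Ts (Φ (Xw, x))) - Real.log (ρ' Ts (Φ (Xw, x)))) ∂τ) ^ 2 ∂τ ≤ σ2) :
    Integrable (fun z => (Real.log (ρ Ts (Φ (U, z))) - Real.log (ρ' Ts (Φ (U, z)))) * (wgt F γ b₀ p₀ j Ts ρ ρ' τ Φ J t) Xw z) τ ∧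
    Integrable (fun z => (Real.log (ρ Ts (Φ (V, z))) - Real.log (ρ' Ts (Φ (V, z)))) * (wgt F γ b₀ p₀ j Ts ρ ρ' τ Φ J t) Xw z) τ ∧
    Integrable (fun z => (Real.log (ρ Ts (Φ (W, z))) - Real.log (ρ' Ts (Φ (W, z)))) * (wgt F γ b₀ p₀ j Ts ρ ρ' τ Φ J t) Xw z) τ ∧
    Integrable (fun z => (Real.log (ρ Ts (Φ (Y, z))) - Real.log (ρ' Ts (Φ (Y, z)))) * (wgt F γ b₀ p₀ j Ts ρ ρ' τ Φ J t) Xw z) τ ∧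
    |∫ z, ((Real.log (ρ Ts (Φ (Y, z))) - Real.log (ρ' Ts (Φ (Y, z)))) - (Real.log (ρ Ts (Φ (V, z))) - Real.log (ρ' Ts (Φ (V, z))))
      - (Real.log (ρ Ts (Φ (W, z))) - Real.log (ρ' Ts (Φ (W, z)))) + (Real.log (ρ Ts (Φ (U, z))) - Real.log (ρ' Ts (Φ (U, z)))))
        * (wgt F γ b₀ p₀ j Ts ρ ρ' τ Φ J t) Xw z ∂τ|
      ≤ (kG + (max ES₀ ES₁ * Real.exp (σ2 / 4)) * kB)
        * (‖m‖ / (θBal F.L γ b₀ p₀ j / 4)) * (‖m'‖ / (θBal F.L γ b₀ p₀ j / 4)) := by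
  have hXw' : PlaqSmall (θBal F.L γ b₀ p₀ j) Xw := fun p => (hXw p).trans_le (div_le_self hθj.le (by norm_num))
  obtain ⟨hES, htail⟩ := setIntegral_wgt_le_of_endpointTails_pathVariance F γ b₀ p₀ j Ts hjTs ρ ρ' hρm hρ'm hρc hρ'c hρpos hθ hχc hχ0 hχsupp hχpos
    τ Φ J hΦm hJm CJ hJle hpos t ht0 ht1 Xw hXw' hGood.compl hES₀ htail₀ htail₁ hvar
  exact jtBracket_sq_of_hdisp_crude F γ b₀ p₀ j Ts hjTs ρ ρ' hρm hρ'm hρc hρ'c hρpos hθ hθj hχc hχ0 hχsupp hχpos τ Φ J hΦm hJm CJ hJle hpos t hc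
    B B' m m' U V W Y Xw hm hm' hU hV hW hY hXw hVU hVb hWU hWb hYV hYb Db hrc0 hDb0 DP hDb hdisp hroom hXwc Good hGood hkG hG hkB hES hcrude htail

end Summit.QuantumFields.YangMills.Theorems.OrganTangentJTSqOfEndpointTails

end
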